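import Literature.Barriers.CriticalPhenomena.WeaklySAWFieldRescaling
import Mathlib.LinearAlgebra.Matrix.Permutation
import HarnessLib

/-!
# BBS 2015, §4.1, eq. (4.13): relabelling of sites, translation invariance of `Ĝ_N`, and
# `χ̂_N = |Λ|⁻¹ E_C((1,φ̄)(1,φ) Z₀)`

Sequel to `WeaklySAWFieldRescaling.lean`. A permutation `π` of the sites acts on the algebra of forms by
renaming `φ_x, ψ_x, ψ̄_x ↦ φ_{πx}, ψ_{πx}, ψ̄_{πx}` (`relabelForm π`: the substitution `φ ↦ φ ∘ π` in the
coefficients composed with the substitution of generators induced by `π` on both copies of `Λ`). Its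
fermionic Jacobian is `sign(π)² = 1` (`det_funLeft_perm`, `Matrix.det_permutation`) and Lebesgue measure on
`ℂ^Λ` is invariant under the relabelling of coordinates, so **`superIntegral_relabelForm`: `∫ F^π = ∫ F`**.
On the torus `Λ = ℤ^d/nℤ^d` the kinetic matrix `-Δ_Λ` is translation invariant
(`negLaplacianC_add_right`), whence

* **`GhatN_add_right`**: `Ĝ_N(m²,g₀,ν₀,z₀; a+h, b+h) = Ĝ_N(m²,g₀,ν₀,z₀; a, b)` (translation invariance of
  the renormalised two-point function `E_C(e^{-V₀(Λ)}φ̄_aφ_b)`), and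
* **`chiHatNForm_eq_card_inv_mul`** = eq. (4.13) of Bauerschmidt–Brydges–Slade, CMP 337 (2015),
  arXiv:1403.7422: `χ̂_N = |Λ|⁻¹ E_C((1,φ̄)(1,φ) Z₀)`, `(1,φ̄) = Σ_x φ̄_x`, `(1,φ) = Σ_x φ_x` ("By (4.8) and
  translation invariance"), for `m² > 0`, `g₀ > 0`, `ν₀ ∈ ℝ`, `z₀ > -1`.

Supporting results: `liftPerm` (`π` on `Λ ⊔ Λ`, `sign = 1`), `genRelabel`, the action of `relabelForm` on
`ofFun`, `ψ`, `ψ̄`, `τ_x`, `fermionAction`, `superGauss` (`B ↦ B ∘ (π⁻¹ × π⁻¹)`), `interactionForm`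
(invariant), `superIntegral_finset_sum` (additivity of `∫` over integrable top coefficients) and
`integrable_berezin_twoPoint` (the top coefficient of `φ̄_aφ_b e^{-S_A}e^{-Σ(gτ²+ντ)}` is integrable,
from the envelope of `WeaklySAWSupersymmetricRepresentationAnalytic.lean`).

Everything is proved; no named facts.

## References
* R. Bauerschmidt, D. C. Brydges, G. Slade, CMP 337 (2015), §4.1, eqs. (4.8) and (4.13).
  [cite: BauerschmidtBrydgesSlade2015LogCorr]
-/

noncomputable section

open MeasureTheory Filter Topology Set Complex ComplexConjugate
open scoped ENNReal
open Literature.Probability.LatticeModels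
open Literature.MathematicalPhysics.QuantumLattice
open Literature.MathematicalPhysics.QuantumLattice.GrassmannAlgebra (berezin gen coeffMap)
open scoped BigOperators

namespace Literature.Barriers.CriticalPhenomena

namespace CTWSAW

/-! ### The determinant of a relabelling of coordinates -/

section DetPerm

variable {R : Type*} [CommRing R] {J : Type*} [Fintype J] [DecidableEq J]

/-- The matrix of `v ↦ v ∘ e` in the standard basis is the permutation matrix of `e`. [folklore] -/
theorem toMatrix'_funLeft_perm (e : Equiv.Perm J) :
    LinearMap.toMatrix' (LinearMap.funLeft R R e) = e.permMatrix R := by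
  ext i j
  simp only [LinearMap.toMatrix'_apply, LinearMap.funLeft_apply, Equiv.Perm.permMatrix, PEquiv.toMatrix_apply,
    Equiv.toPEquiv_apply, Option.mem_def, Option.some.injEq]
  by_cases h : e i = j
  · simp [h]
  · simp [h]

/-- **`det(v ↦ v ∘ e) = sign e`** for a permutation `e` of the coordinates. [folklore] -/
theorem det_funLeft_perm (e : Equiv.Perm J) :
    LinearMap.det (LinearMap.funLeft R R e) = (((Equiv.Perm.sign e : ℤˣ) : ℤ) : R) := by
  rw [← LinearMap.det_toMatrix', toMatrix'_funLeft_perm, Matrix.det_permutation]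

end DetPerm

/-! ### Relabelling the sites of a form -/

section Relabel

variable {Λ : Type*} [Fintype Λ] [LinearOrder Λ]

/-- A permutation of the sites acting on both copies `Λ ⊔ Λ` (indices of `ψ̄` and of `ψ`). [folklore] -/
def liftPerm (π : Equiv.Perm Λ) : Equiv.Perm (Λ ⊕ₗ Λ) := (toLex (α := Λ ⊕ Λ)).permCongr (Equiv.sumCongr π π)

omit [Fintype Λ] [LinearOrder Λ] in
/-- `liftPerm π` on a `ψ`-index. [folklore] -/
theorem liftPerm_inr (π : Equiv.Perm Λ) (x : Λ) : liftPerm π (toLex (Sum.inr x)) = toLex (Sum.inr (π x)) := by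
  simp [liftPerm, Equiv.permCongr_apply]

omit [Fintype Λ] [LinearOrder Λ] in
/-- `liftPerm π` on a `ψ̄`-index. [folklore] -/
theorem liftPerm_inl (π : Equiv.Perm Λ) (x : Λ) : liftPerm π (toLex (Sum.inl x)) = toLex (Sum.inl (π x)) := by
  simp [liftPerm, Equiv.permCongr_apply]

/-- `sign (liftPerm π) = sign(π)² = 1`. [folklore] -/
theorem sign_liftPerm (π : Equiv.Perm Λ) : Equiv.Perm.sign (liftPerm π) = 1 := by
  rw [liftPerm, Equiv.Perm.sign_permCongr, Equiv.Perm.sign_sumCongr, Int.units_mul_self]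

/-- The substitution of generators `ψ_x, ψ̄_x ↦ ψ_{πx}, ψ̄_{πx}` (an algebra endomorphism over the
`0`-forms; `v ↦ v ∘ (liftPerm π)⁻¹` on the generator module). [folklore] -/
def genRelabel (π : Equiv.Perm Λ) : SForm Λ →ₐ[FieldFun Λ] SForm Λ :=
  ExteriorAlgebra.map (LinearMap.funLeft (FieldFun Λ) (FieldFun Λ) (liftPerm π).symm)

omit [Fintype Λ] in
/-- `Pi.single j 1 ∘ e⁻¹ = Pi.single (e j) 1`. [folklore] -/
theorem single_comp_perm_symm (e : Equiv.Perm (Λ ⊕ₗ Λ)) (j : Λ ⊕ₗ Λ) :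
    (fun i => (Pi.single j (1 : FieldFun Λ) : (Λ ⊕ₗ Λ) → FieldFun Λ) (e.symm i)) = Pi.single (e j) 1 := by
  funext i
  simp only [Pi.single_apply, Equiv.symm_apply_eq]

omit [Fintype Λ] in
/-- `genRelabel π` sends the generator `θ_j` to `θ_{liftPerm π j}`. [folklore] -/
theorem genRelabel_gen (π : Equiv.Perm Λ) (j : Λ ⊕ₗ Λ) :
    genRelabel π (gen (FieldFun Λ) j) = gen (FieldFun Λ) (liftPerm π j) := by
  rw [genRelabel, gen, gen, ExteriorAlgebra.map_apply_ι]
  congr 1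
  rw [show (LinearMap.funLeft (FieldFun Λ) (FieldFun Λ) ⇑(liftPerm π).symm) (Pi.single j 1) =
      fun i => (Pi.single j (1 : FieldFun Λ) : (Λ ⊕ₗ Λ) → FieldFun Λ) ((liftPerm π).symm i) from rfl,
    single_comp_perm_symm]

omit [Fintype Λ] [LinearOrder Λ] in
/-- `genRelabel` fixes the `0`-forms. [folklore] -/
theorem genRelabel_ofFun (π : Equiv.Perm Λ) (f : FieldFun Λ) : genRelabel π (ofFun f) = (ofFun f : SForm Λ) := by
  unfold ofFun; exact AlgHom.commutes _ f

/-- **Relabelling of sites `F ↦ F^π`**: `φ_x, ψ_x, ψ̄_x ↦ φ_{πx}, ψ_{πx}, ψ̄_{πx}` — the substitution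
`φ ↦ φ ∘ π` in the coefficients followed by the relabelling of the generators.
[cite: BauerschmidtBrydgesSlade2015LogCorr, §4.1, eq. (4.13) ("by (4.8) and translation invariance")] -/
def relabelForm (π : Equiv.Perm Λ) : SForm Λ →+* SForm Λ where
  toFun K := genRelabel π (substForm (fun φ => φ ∘ π) K)
  map_one' := by simp
  map_mul' x y := by simp
  map_zero' := by simp
  map_add' x y := by simp

/-- Unfolding `relabelForm`. [folklore] -/
theorem relabelForm_apply (π : Equiv.Perm Λ) (K : SForm Λ) :
    relabelForm π K = genRelabel π (substForm (fun φ => φ ∘ π) K) := rfl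

/-- `F ↦ F^π` on `0`-forms: `f(φ) ↦ f(φ ∘ π)`. [folklore] -/
theorem relabelForm_ofFun (π : Equiv.Perm Λ) (f : FieldFun Λ) :
    relabelForm π (ofFun f) = ofFun (fun φ => f (φ ∘ π)) := by
  rw [relabelForm_apply, substForm_ofFun, genRelabel_ofFun]

/-- `F ↦ F^π` on `ψ_x`: `ψ_x ↦ ψ_{πx}`. [folklore] -/
theorem relabelForm_psi (π : Equiv.Perm Λ) (x : Λ) :
    relabelForm π (psi (FieldFun Λ) x) = psi (FieldFun Λ) (π x) := by
  rw [relabelForm_apply, substForm_psi, psi, psi, genRelabel_gen, liftPerm_inr]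

/-- `F ↦ F^π` on `ψ̄_x`: `ψ̄_x ↦ ψ̄_{πx}`. [folklore] -/
theorem relabelForm_psiBar (π : Equiv.Perm Λ) (x : Λ) :
    relabelForm π (psiBar (FieldFun Λ) x) = psiBar (FieldFun Λ) (π x) := by
  rw [relabelForm_apply, substForm_psiBar, psiBar, psiBar, genRelabel_gen, liftPerm_inl]

/-- `F ↦ F^π` is semilinear over the `0`-forms. [folklore] -/
theorem relabelForm_smul (π : Equiv.Perm Λ) (f : FieldFun Λ) (K : SForm Λ) :
    relabelForm π (f • K) = fieldPrecomp (fun φ => φ ∘ π) f • relabelForm π K := by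
  rw [relabelForm_apply, substForm_smul, map_smul, relabelForm_apply]

/-- `τ_x ↦ τ_{πx}`. [folklore] -/
theorem relabelForm_tau (π : Equiv.Perm Λ) (x : Λ) : relabelForm π (tau x) = tau (π x) := by
  rw [tau, tau, map_add, map_mul, relabelForm_ofFun, relabelForm_psi, relabelForm_psiBar]
  rfl

/-- `ψ̄_xψ_x ↦ ψ̄_{πx}ψ_{πx}`. [folklore] -/
theorem relabelForm_pairBar (π : Equiv.Perm Λ) (x : Λ) : relabelForm π (pairBar x) = pairBar (π x) := by
  rw [pairBar, pairBar, map_mul, relabelForm_psi, relabelForm_psiBar]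

/-- `ψBψ̄ ↦ ψ(B ∘ (π⁻¹×π⁻¹))ψ̄`. [folklore] -/
theorem relabelForm_fermionAction (π : Equiv.Perm Λ) (B : Matrix Λ Λ ℂ) :
    relabelForm π (fermionAction B) = fermionAction (B.submatrix π.symm π.symm) := by
  unfold fermionAction
  rw [map_sum]
  simp_rw [map_sum, relabelForm_smul, fieldPrecomp_constFun, map_mul, relabelForm_psi, relabelForm_psiBar]
  -- reindex both sums by `π`
  refine (Fintype.sum_equiv π _ _ fun x => ?_)
  refine (Fintype.sum_equiv π _ _ fun y => ?_)
  simp only [Matrix.submatrix_apply, Equiv.symm_apply_apply]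

omit [LinearOrder Λ] in
/-- `(φ∘π)B(φ∘π)‾ = φ(B ∘ (π⁻¹×π⁻¹))φ̄`. [folklore] -/
theorem quadForm_comp_perm (B : Matrix Λ Λ ℂ) (π : Equiv.Perm Λ) (φ : Λ → ℂ) :
    Boson.quadForm B (φ ∘ π) = Boson.quadForm (B.submatrix π.symm π.symm) φ := by
  unfold Boson.quadForm
  refine (Fintype.sum_equiv π _ _ fun x => ?_)
  refine (Fintype.sum_equiv π _ _ fun y => ?_)
  simp only [Function.comp_apply, Matrix.submatrix_apply, Equiv.symm_apply_apply]

/-- **`e^{-S_B} ↦ e^{-S_{B∘(π⁻¹×π⁻¹)}}`**. [folklore] -/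
theorem relabelForm_superGauss (π : Equiv.Perm Λ) (B : Matrix Λ Λ ℂ) :
    relabelForm π (superGauss B) = superGauss (B.submatrix π.symm π.symm) := by
  have hnil : IsNilpotent (-fermionAction B) := by
    rw [fermionAction_eq_neg_quadratic, neg_neg]; exact isNilpotent_quadratic _ _
  rw [superGauss, superGauss, map_mul, relabelForm_ofFun, grassmannExp, hnil.map_exp (relabelForm π),
    ← grassmannExp, map_neg, relabelForm_fermionAction]
  congr 2
  funext φ
  rw [Boson.gaussWeight, Boson.gaussWeight, quadForm_comp_perm]

/-- **`e^{-Σ(gτ²+ντ)}` is invariant under relabelling of sites.** [folklore] -/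
theorem relabelForm_interactionForm (π : Equiv.Perm Λ) (g ν : ℝ) :
    relabelForm π (interactionForm g ν) = (interactionForm g ν : SForm Λ) := by
  rw [interactionForm, map_mul, relabelForm_ofFun, grassmannExp, (isNilpotent_quadratic _ _).map_exp (relabelForm π),
    ← grassmannExp, quadratic_diagonal, map_sum]
  congr 2
  · funext φ
    congr 2
    exact Fintype.sum_equiv π _ _ fun x => rfl
  · simp_rw [relabelForm_smul, relabelForm_pairBar]
    exact Fintype.sum_equiv π _ _ fun x => rfl

/-- `φ̄_aφ_b ↦ φ̄_{πa}φ_{πb}`. [folklore] -/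
theorem relabelForm_ofFun_twoPoint (π : Equiv.Perm Λ) (a b : Λ) :
    relabelForm π (ofFun fun φ => φ b * conj (φ a)) = ofFun (fun φ : Λ → ℂ => φ (π b) * conj (φ (π a))) := by
  rw [relabelForm_ofFun]; rfl

/-! #### No Jacobian -/

/-- The fermionic Jacobian of a relabelling is `sign(π)² = 1`: `∫dψ̄dψ F^π|_{gen} = ∫dψ̄dψ F`. [folklore] -/
theorem berezin_genRelabel (π : Equiv.Perm Λ) (K : SForm Λ) :
    berezin (FieldFun Λ) (Λ ⊕ₗ Λ) (genRelabel π K) = berezin (FieldFun Λ) (Λ ⊕ₗ Λ) K := by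
  rw [genRelabel, GrassmannAlgebra.berezin_map, det_funLeft_perm, ← Equiv.Perm.inv_def, Equiv.Perm.sign_inv,
    sign_liftPerm, Units.val_one, Int.cast_one, one_mul]

/-- Top coefficient of the relabelled form: `[F^π]_{top}(φ) = [F]_{top}(φ ∘ π)`. [folklore] -/
theorem berezin_relabelForm_apply (π : Equiv.Perm Λ) (K : SForm Λ) (φ : Λ → ℂ) :
    berezin (FieldFun Λ) (Λ ⊕ₗ Λ) (relabelForm π K) φ = berezin (FieldFun Λ) (Λ ⊕ₗ Λ) K (φ ∘ π) := by
  rw [relabelForm_apply, berezin_genRelabel, berezin_substForm_apply]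

omit [LinearOrder Λ] in
/-- Lebesgue measure on `ℂ^Λ` is invariant under relabelling of the coordinates. [folklore] -/
theorem integral_comp_perm (π : Equiv.Perm Λ) (G : (Λ → ℂ) → ℂ) :
    ∫ φ : Λ → ℂ, G (φ ∘ π) = ∫ φ : Λ → ℂ, G φ := by
  have hmp := volume_measurePreserving_piCongrLeft (fun _ : Λ => ℂ) π.symm
  have hfun : ∀ φ : Λ → ℂ, (MeasurableEquiv.piCongrLeft (fun _ : Λ => ℂ) π.symm) φ = φ ∘ π := by
    intro φ; funext x
    simp only [MeasurableEquiv.coe_piCongrLeft, Equiv.piCongrLeft_apply, Equiv.symm_symm, eq_rec_constant,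
      Function.comp_apply]
  have h := hmp.integral_comp' G
  simp_rw [hfun] at h
  exact h

/-- **`∫ F^π = ∫ F`**: the super-integral is invariant under relabelling of the sites (no fermionic
Jacobian, `sign(π)² = 1`; Lebesgue measure is permutation invariant). [cite: BauerschmidtBrydgesSlade2015LogCorr, §4.1, eq. (4.13) ("translation invariance")] -/
theorem superIntegral_relabelForm (π : Equiv.Perm Λ) (K : SForm Λ) :
    superIntegral (relabelForm π K) = superIntegral K := by
  unfold superIntegral
  congr 1
  simp_rw [berezin_relabelForm_apply]
  exact integral_comp_perm π _

/-! #### Additivity of the super-integral over finite sums -/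

/-- `∫ Σ_i K_i = Σ_i ∫ K_i` when every top coefficient is integrable. [folklore] -/
theorem superIntegral_finset_sum {ι : Type*} (s : Finset ι) (K : ι → SForm Λ)
    (hK : ∀ i ∈ s, Integrable fun φ => berezin (FieldFun Λ) (Λ ⊕ₗ Λ) (K i) φ) :
    superIntegral (∑ i ∈ s, K i) = ∑ i ∈ s, superIntegral (K i) := by
  unfold superIntegral
  rw [map_sum]
  have h : ∫ φ : Λ → ℂ, (∑ i ∈ s, berezin (FieldFun Λ) (Λ ⊕ₗ Λ) (K i)) φ =
      ∑ i ∈ s, ∫ φ : Λ → ℂ, berezin (FieldFun Λ) (Λ ⊕ₗ Λ) (K i) φ := by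
    rw [← integral_finsetSum s hK]
    exact integral_congr_ae (Eventually.of_forall fun φ => by simp only [Finset.sum_apply])
  rw [h, Finset.mul_sum]

/-- **The top coefficient of `φ̄_aφ_b e^{-S_A}e^{-Σ(gτ²+ντ)}` is integrable** (`Re φAφ̄ ≥ 0`, `g > 0`):
domination by the envelope of `WeaklySAWSupersymmetricRepresentationAnalytic.lean`. [folklore] -/
theorem integrable_berezin_twoPoint [Nonempty Λ] {A : Matrix Λ Λ ℂ} (hA : ∀ φ, 0 ≤ (Boson.quadForm A φ).re)
    {g : ℝ} (hg : 0 < g) (ν : ℝ) (a b : Λ) :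
    Integrable fun φ => berezin (FieldFun Λ) (Λ ⊕ₗ Λ)
      (ofFun (fun φ => φ b * conj (φ a)) * (superGauss A * interactionForm g ν)) φ := by
  have hR : 0 ≤ ‖(ν : ℂ)‖ := norm_nonneg _
  have hb := norm_topC_le_and hA hg hR (le_refl ‖(ν : ℂ)‖) a b
  have hint : Integrable fun φ => topC A g a b (ν : ℂ) φ :=
    (integrable_envelope A g ‖(ν : ℂ)‖).mono' (continuous_topC A g a b (ν : ℂ)).aestronglyMeasurable
      (Eventually.of_forall fun φ => (hb φ).1)
  refine hint.congr (Eventually.of_forall fun φ => ?_)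
  dsimp only
  rw [← interactionFormC_ofReal, berezin_ofFun_mul_superGauss_mul_interactionFormC_apply, topC]

end Relabel

/-! ### The torus: translation invariance of `Ĝ_N` and eq. (4.13) -/

section Torus

variable {d n : ℕ} [NeZero n]

omit [NeZero n] in
/-- **`-Δ_Λ` is translation invariant**: `(-Δ)_{x+h,y+h} = (-Δ)_{x,y}`. [folklore] -/
theorem negLaplacianC_add_right (x y h : TorusSite d n) :
    negLaplacianC d n (x + h) (y + h) = negLaplacianC d n x y := by
  have h1 : (x + h = y + h) = (x = y) := propext (add_left_inj h)
  have h2 : ∀ e : SRW.Dir d, (y + h = x + h + torusStep n e) = (y = x + torusStep n e) := by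
    intro e
    rw [add_right_comm x h]
    exact propext (add_left_inj h)
  simp only [negLaplacianC, schrodingerMatrixC, Matrix.sub_apply, Matrix.diagonal_apply, torusStepMatrixC,
    Matrix.map_apply, torusStepMatrix_apply, Pi.zero_apply, h1, h2]

attribute [-instance] Fintype.decidablePiFintype

omit [NeZero n] in
/-- `(s(-Δ)) ∘ (τ_h⁻¹ × τ_h⁻¹) = s(-Δ)` for the translation `τ_h = (· + h)`. [folklore] -/
theorem smul_negLaplacianC_submatrix_addRight (s : ℂ) (h : TorusSite d n) :
    (s • negLaplacianC d n).submatrix (Equiv.addRight h).symm (Equiv.addRight h).symm = s • negLaplacianC d n := by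
  ext x y
  simp only [Matrix.submatrix_apply, Matrix.smul_apply, Equiv.addRight_symm, Equiv.coe_addRight,
    negLaplacianC_add_right]

/-- **Translation invariance of the renormalised two-point function**:
`Ĝ_N(m²,g₀,ν₀,z₀; a+h, b+h) = Ĝ_N(m²,g₀,ν₀,z₀; a, b)` (`m² > 0`).
[cite: BauerschmidtBrydgesSlade2015LogCorr, §4.1, eq. (4.13) ("by (4.8) and translation invariance")] -/
theorem GhatN_add_right {m2 : ℝ} (hm : 0 < m2) (g₀ ν₀ z₀ : ℝ) (a b h : TorusSite d n) :
    GhatN d n m2 g₀ ν₀ z₀ (a + h) (b + h) = GhatN d n m2 g₀ ν₀ z₀ a b := by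
  rw [GhatN_eq_formSide hm, GhatN_eq_formSide hm,
    ← superIntegral_relabelForm (Equiv.addRight h) (ofFun (fun φ => φ b * conj (φ a)) * _), map_mul, map_mul,
    relabelForm_ofFun_twoPoint, relabelForm_superGauss, smul_negLaplacianC_submatrix_addRight,
    relabelForm_interactionForm]
  rfl

/-- `Σ_a Σ_b Ĝ_N(a,b) = |Λ| Σ_x Ĝ_N(0,x)`. [folklore] -/
theorem sum_sum_GhatN {m2 : ℝ} (hm : 0 < m2) (g₀ ν₀ z₀ : ℝ) :
    ∑ a : TorusSite d n, ∑ b : TorusSite d n, GhatN d n m2 g₀ ν₀ z₀ a b =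
      (Fintype.card (TorusSite d n) : ℂ) * chiHatNForm d n m2 g₀ ν₀ z₀ := by
  have h : ∀ a : TorusSite d n, ∑ b, GhatN d n m2 g₀ ν₀ z₀ a b = chiHatNForm d n m2 g₀ ν₀ z₀ := by
    intro a
    rw [chiHatNForm]
    refine Fintype.sum_equiv (Equiv.addRight (-a)) _ _ fun b => ?_
    rw [← GhatN_add_right hm g₀ ν₀ z₀ a b (-a), add_neg_cancel]
    rfl
  simp_rw [h]
  rw [Finset.sum_const, Finset.card_univ, nsmul_eq_mul]

/-- `(1,φ̄)(1,φ) = Σ_a Σ_b φ̄_aφ_b` as a `0`-form. [folklore] -/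
theorem ofFun_oneBarPhi_mul_onePhi :
    (ofFun (fun φ : TorusSite d n → ℂ => (∑ a, conj (φ a)) * ∑ b, φ b) : SForm (TorusSite d n)) =
      ∑ a, ∑ b, ofFun (fun φ : TorusSite d n → ℂ => φ b * conj (φ a)) := by
  have hofFun_sum : ∀ f : TorusSite d n → FieldFun (TorusSite d n),
      (∑ x, ofFun (f x) : SForm (TorusSite d n)) = ofFun (∑ x, f x) := fun f => by
    unfold ofFun; exact (map_sum (algebraMap (FieldFun (TorusSite d n)) (SForm (TorusSite d n))) f _).symm
  simp_rw [hofFun_sum]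
  congr 1
  funext φ
  rw [Finset.sum_apply, Finset.sum_mul]
  refine Finset.sum_congr rfl fun a _ => ?_
  rw [Finset.sum_apply, Finset.mul_sum]
  exact Finset.sum_congr rfl fun b _ => mul_comm _ _

/-- **BBS 2015, eq. (4.13): `χ̂_N = |Λ|⁻¹ E_C((1,φ̄)(1,φ) Z₀)`**, `Z₀ = e^{-V₀(Λ)}`, `C = (-Δ+m²)⁻¹`,
`(1,φ̄) = Σ_xφ̄_x`, `(1,φ) = Σ_xφ_x` — from (4.8) `χ̂_N = Σ_x E_C(Z₀φ̄_0φ_x)` and translation invariance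
(`m² > 0`, `g₀ > 0`, `ν₀ ∈ ℝ`, `z₀ > -1`). [cite: BauerschmidtBrydgesSlade2015LogCorr, §4.1, eq. (4.13)] -/
theorem chiHatNForm_eq_card_inv_mul {m2 g₀ : ℝ} (hm : 0 < m2) (hg₀ : 0 < g₀) (ν₀ : ℝ) {z₀ : ℝ} (hz : -1 < z₀) :
    chiHatNForm d n m2 g₀ ν₀ z₀ = (Fintype.card (TorusSite d n) : ℂ)⁻¹ *
      superExpectation (freeCovariance d n m2)
        (ofFun (fun φ : TorusSite d n → ℂ => (∑ a, conj (φ a)) * ∑ b, φ b) * boltzmannZ0 g₀ ν₀ z₀) := by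
  have hcard : (Fintype.card (TorusSite d n) : ℂ) ≠ 0 := by
    exact_mod_cast (Fintype.card_pos (α := TorusSite d n)).ne'
  have hs : 0 < 1 + z₀ := by linarith
  -- each summand `E_C(φ̄_aφ_b Z₀) = Ĝ_N(a,b)` and its top coefficient is integrable
  have hterm : ∀ a b : TorusSite d n,
      superGauss (freeCovariance d n m2)⁻¹ * (ofFun (fun φ : TorusSite d n → ℂ => φ b * conj (φ a)) *
        boltzmannZ0 g₀ ν₀ z₀) =
      ofFun (fun φ : TorusSite d n → ℂ => φ b * conj (φ a)) *
        (superGauss ((((1 + z₀ : ℝ)) : ℂ) • negLaplacianC d n) * interactionForm g₀ (ν₀ + m2)) := by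
    intro a b
    rw [freeCovariance_inv hm, boltzmannZ0, ← mul_assoc, (commute_superGauss _ _).eq, mul_assoc, ← mul_assoc (superGauss _),
      massLaplacianC, superGauss_mul_superGauss,
      show negLaplacianC d n + Matrix.diagonal (fun _ => (m2 : ℂ)) + (z₀ : ℂ) • negLaplacianC d n =
        (((1 + z₀ : ℝ)) : ℂ) • negLaplacianC d n + Matrix.diagonal (fun _ => (m2 : ℂ)) by
          push_cast; rw [add_smul, one_smul]; abel,
      superGauss_add_diagonal_mul_interactionForm]
  have hA : ∀ φ, 0 ≤ (Boson.quadForm ((((1 + z₀ : ℝ)) : ℂ) • negLaplacianC d n) φ).re :=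
    re_quadForm_smul_nonneg re_quadForm_negLaplacianC_nonneg hs.le
  -- the summands `K_{ab} = φ̄_aφ_b e^{-S_{(1+z₀)(-Δ)}} e^{-Σ(g₀τ²+(ν₀+m²)τ)}`
  set K : TorusSite d n → TorusSite d n → SForm (TorusSite d n) := fun a b =>
    ofFun (fun φ : TorusSite d n → ℂ => φ b * conj (φ a)) *
      (superGauss ((((1 + z₀ : ℝ)) : ℂ) • negLaplacianC d n) * interactionForm g₀ (ν₀ + m2)) with hK
  have hint : ∀ a b, Integrable fun φ => berezin (FieldFun (TorusSite d n)) (TorusSite d n ⊕ₗ TorusSite d n)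
      (K a b) φ := fun a b => integrable_berezin_twoPoint hA hg₀ _ a b
  have hinner : ∀ a : TorusSite d n, superGauss (freeCovariance d n m2)⁻¹ *
      ((∑ b, ofFun (fun φ : TorusSite d n → ℂ => φ b * conj (φ a))) * boltzmannZ0 g₀ ν₀ z₀) = ∑ b, K a b := by
    intro a
    rw [Finset.sum_mul, Finset.mul_sum]
    exact Finset.sum_congr rfl fun b _ => hterm a b
  have hrow : ∀ a : TorusSite d n, superIntegral (∑ b, K a b) = ∑ b, superIntegral (K a b) := fun a =>
    superIntegral_finset_sum _ _ fun b _ => hint a b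
  have hGhat : ∀ a b : TorusSite d n, superIntegral (K a b) = GhatN d n m2 g₀ ν₀ z₀ a b := fun a b => by
    rw [GhatN_eq_formSide hm]
  rw [superExpectation, ofFun_oneBarPhi_mul_onePhi, Finset.sum_mul, Finset.mul_sum]
  simp_rw [hinner]
  rw [superIntegral_finset_sum _ _ fun a _ => ?_]
  · simp_rw [hrow, hGhat]
    rw [sum_sum_GhatN hm, ← mul_assoc, inv_mul_cancel₀ hcard, one_mul]
  · have h : (fun φ => berezin (FieldFun (TorusSite d n)) (TorusSite d n ⊕ₗ TorusSite d n) (∑ b, K a b) φ) =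
        fun φ => ∑ b, berezin (FieldFun (TorusSite d n)) (TorusSite d n ⊕ₗ TorusSite d n) (K a b) φ := by
      funext φ; rw [map_sum, Finset.sum_apply]
    rw [h]
    exact integrable_finsetSum _ fun b _ => hint a b

end Torus

end CTWSAW

end Literature.Barriers.CriticalPhenomena
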